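import Summits.HodgeConjecture.HodgeConjecture.Cruxes.BlochSeedDiscOne.DepthBoundA4

/-!
# QuarterCosetCalculus — the 16-cell quarter coset is clean up to ONE character; split pairs and the even-sign octet
(plan-lens-HodgeAV-extremal g9, memo `VERTEX-STRUCTURE-extremal-g9.md` §2.2–2.3)

Token: line stmt-HodgeConjecture-18881 Cruxes/BlochSeedDiscOne/Lines/birth.lean 814a6a70c14e831a stub_rung_pad4_seedAt.

EVIDENCE-LEVEL TYPED FILE (kernel-checked finite facts about the rotation torus `(ℤ∕4)⁴`; NOT a rung; nothing here is proved toward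
HC ∕ HC_CM ∕ HC_AV ∕ №4 ∕ 26512 ∕ 18881 ∕ H2; letters ≠ sheaves ≠ a SEED).  Model of record: `DepthBoundA4.lean` (`Word`, `Sym.phase`,
`Word.rotPhase`, `rotCell`, `cellCoef_rotCell_phase`, `Design.T`, `Design.mu`) ; the rotation-list machinery of g8's `HalfCosetGadget.lean` (`allK`, `sumK`, `psiK`,
`quarterCosetKs`, `charSum`, `Sym.strip`, the strip bridge) is RE-DECLARED here with suffix `9` so that this file imports `DepthBoundA4` only
(the farm builds `DepthBoundA4`; the two files can be imported side by side without name clashes).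

CONTENT (memo-09 §2.2, the «quarter-coset calculus»).  `K := {k : Σk ≡ 0, ψ(k) ≡ 0}` (order 16) has annihilator `K^⊥ = ⟨(1,1,1,1), (0,1,2,3)⟩`,
and `K^⊥` meets the (A1).1 scope in exactly the two patterns `±(1,3,1,3)`, i.e. the words `ē e ē e` and `e ē e ē` (the character
`χ = 𝟙 + 2ψ`).  Hence the QUARTER COSET `Q_{s,t} = {Σk ≡ s, ψ(k) ≡ t}` (16 rotation vectors) kills EVERY scope pattern except these two,
on which its character sum is `16·i^{±(s+2t)}`; on `eeee` it is `16·(−i)^s`.  Consequences recorded here: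
 * `quarter_kills_scope_pattern` — 81 patterns × 16 quarter cosets (`decide +kernel`): zero off the two χ-words;
 * `quarter_chi`, `quarter_eeee` — the surviving values `16·i^{s+2t}`, `16·(−i)^{s+2t}`, `16·(−i)^s`;
 * `quarterPair_scope_pattern` ∕ `quarterPair_scope` — `Q_{s,t}` and `Q_{s+2,t+1}` have THE SAME character sum on every scope word
   (the χ-phase `i^{s+2t}` is invariant under `(s,t) ↦ (s+2,t+1)`), while their `eeee` sums differ by `32·(−i)^s` (`quarterPair_eeee`);
 * DESIGN LEVEL: the SPLIT QUARTER PAIR `splitQuarterDesign x s t` = `Q_{s,t}·x` on the N side and `Q_{s+2,t+1}·x` on the P side (any base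
   cell `x`, 16 + 16 cells, rank 0) satisfies (A1).1 ON ITS OWN (`splitQuarterDesign_mixed_clean`) with `μ = 32·(−i)^s·cellCoef x eeee`
   (`splitQuarterDesign_mu`) — a second 32-cell μ-gadget next to g8's half-coset `Q_{s,t} ∪ Q_{s,t+1}` (both are instances of one rule:
   two quarter cosets whose χ-phases cancel in `T = Σ_N − Σ_P`);
 * `evenSign_scalar_only` — the EVEN-SIGN OCTET `E₈ = {k ∈ {0,2}⁴ : #{f : k_f = 2} even}` (8 rotation vectors) kills every scope pattern
   having an e-free slot and has character sum `8` on each of the 14 all-charged scope patterns and on `eeee` (the finest «clean except on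
   scalars» piece; memo-09 §2.2).
Pencil context (memo-09 §2.1, machine-certified in `memo-09/data/torus9.json`, NOT re-proved here): over the full integer lattice of clean
functions on `(ℤ∕4)⁴` (rank 178) the Bloch character generates the ideal `16(1+i)ℤ[i]`, and a non-negative clean function with non-zero
Bloch character has mass ≥ 32 — so 32 is the minimum for a μ-carrying clean rotation piece on one base cell, attained by the two gadgets.

Kernel hygiene: imports `DepthBoundA4` only; `decide +kernel` on closed finite statements; 0 `sorry`; no `native_decide`; no axiom ∕
instance ∕ notation; no `set_option allowUnsafeReducibility`.
-/

set_option linter.dupNamespace false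
set_option autoImplicit false
set_option maxRecDepth 4096
set_option maxHeartbeats 4000000
set_option synthInstance.maxHeartbeats 400000
set_option synthInstance.maxSize 1024

namespace Summit.HodgeConjecture.HodgeConjecture.Cruxes.BlochSeedDiscOne.DepthBoundA4

section quartercoset

/-- all `4⁴ = 256` rotation vectors, as an explicit list (copy of `HalfCosetGadget.allK`; this file imports `DepthBoundA4` only). -/
def allK9 : List (Fin 4 → Fin 4) :=
  (List.finRange 4).flatMap fun a => (List.finRange 4).flatMap fun b =>
    (List.finRange 4).flatMap fun c => (List.finRange 4).map fun d => ![a, b, c, d]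

/-- `Σ_f k_f (mod 4)` — the `S₀`-coset label. -/
def sumK9 (k : Fin 4 → Fin 4) : ℕ := ((k 0).val + (k 1).val + (k 2).val + (k 3).val) % 4

/-- `ψ(k) = k₁ + 2k₂ + 3k₃ (mod 4)`. -/
def psiK9 (k : Fin 4 → Fin 4) : ℕ := ((k 1).val + 2 * (k 2).val + 3 * (k 3).val) % 4

/-- the QUARTER COSET `Q_{s,t} = {k : Σk ≡ s, ψ(k) ≡ t}` (a coset of `K = ker Σ ∩ ker ψ`, order 16). -/
def quarterKs (s t : Fin 4) : List (Fin 4 → Fin 4) :=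
  allK9.filter fun k => decide (sumK9 k = s.val ∧ psiK9 k = t.val)

/-- character sum `Σ_{k ∈ L} ρ(w,k)`. -/
def charSum9 (w : Word) (L : List (Fin 4 → Fin 4)) : GaussianInt := (L.map fun k => w.rotPhase k).sum

/-- `ρ(w,k)` only sees the PHASE PATTERN of `w`: strip e-free symbols to `1`. -/
def Sym.strip9 (σ : Sym) : Sym := if σ.efree then Sym.one else σ

theorem Sym.strip9_phase (σ : Sym) : σ.strip9.phase = σ.phase := by cases σ <;> rfl
theorem Sym.strip9_efree (σ : Sym) : σ.strip9.efree = σ.efree := by cases σ <;> rfl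
theorem Sym.strip9_strip9 (σ : Sym) : σ.strip9.strip9 = σ.strip9 := by cases σ <;> rfl
theorem Sym.strip9_eq_e (σ : Sym) : σ.strip9 = Sym.e ↔ σ = Sym.e := by cases σ <;> simp [Sym.strip9, Sym.efree]
theorem Sym.strip9_eq_ebar (σ : Sym) : σ.strip9 = Sym.ebar ↔ σ = Sym.ebar := by cases σ <;> simp [Sym.strip9, Sym.efree]

/-- the four symbols are already stripped (i.e. lie in `{1, e, ē}`). -/
def stripFixed9 (a b c d : Sym) : Bool := decide (a.strip9 = a ∧ b.strip9 = b ∧ c.strip9 = c ∧ d.strip9 = d)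

/-- the stripped word. -/
def Word.strip9 (w : Word) : Word := fun f => (w f).strip9

theorem rotPhase_strip9 (w : Word) (k : Fin 4 → Fin 4) : w.strip9.rotPhase k = w.rotPhase k := by
  unfold Word.rotPhase Word.strip9
  exact Finset.prod_congr rfl fun f _ => by rw [Sym.strip9_phase]

theorem charSum9_strip (w : Word) (L : List (Fin 4 → Fin 4)) : charSum9 w.strip9 L = charSum9 w L := by
  unfold charSum9
  congr 1
  exact List.map_congr_left fun k _ => rotPhase_strip9 w k

/-- the two χ-patterns `ē e ē e`, `e ē e ē` (the scope words a quarter coset does not kill). -/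
def chiFixed (a b c d : Sym) : Bool :=
  decide ((a = Sym.ebar ∧ b = Sym.e ∧ c = Sym.ebar ∧ d = Sym.e) ∨ (a = Sym.e ∧ b = Sym.ebar ∧ c = Sym.e ∧ d = Sym.ebar))

theorem quarterKs_length : ∀ s t : Fin 4, (quarterKs s t).length = 16 := by decide +kernel

theorem quarterKs_sum : ∀ s t : Fin 4, ∀ k ∈ quarterKs s t, sumK9 k = s.val ∧ psiK9 k = t.val := by decide +kernel

/-- **QUARTER GADGET (pattern form, kernel).** For every phase pattern in the (A1).1 scope OTHER than the two χ-patterns, and every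
`s, t`, the character sum over the quarter coset `Q_{s,t}` vanishes. -/
theorem quarter_kills_scope_pattern :
    ∀ a b c d : Sym, stripFixed9 a b c d = true → chiFixed a b c d = false →
      ¬ (∀ f : Fin 4, ((![a, b, c, d] : Word) f).efree = true) → (![a, b, c, d] : Word) ≠ Word.eeee → (![a, b, c, d] : Word) ≠ Word.EEEE →
      ∀ s t : Fin 4, charSum9 ![a, b, c, d] (quarterKs s t) = 0 := by
  decide +kernel

/-- the surviving character: `Σ_{k ∈ Q_{s,t}} ρ(ēeēe,k) = 16·i^{s+2t}` and `Σ ρ(eēeē,k) = 16·(−i)^{s+2t}`. -/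
theorem quarter_chi : ∀ s t : Fin 4,
    charSum9 ![Sym.ebar, Sym.e, Sym.ebar, Sym.e] (quarterKs s t) = 16 * (⟨0, 1⟩ : GaussianInt) ^ ((s.val + 2 * t.val) % 4) ∧
    charSum9 ![Sym.e, Sym.ebar, Sym.e, Sym.ebar] (quarterKs s t) = 16 * (⟨0, -1⟩ : GaussianInt) ^ ((s.val + 2 * t.val) % 4) := by
  decide +kernel

/-- on the Bloch word: `Σ_{k ∈ Q_{s,t}} ρ(eeee,k) = 16·(−i)^s`. -/
theorem quarter_eeee : ∀ s t : Fin 4, charSum9 Word.eeee (quarterKs s t) = 16 * (⟨0, -1⟩ : GaussianInt) ^ s.val := by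
  decide +kernel

/-- **SPLIT PAIR (pattern form).** `Q_{s,t}` and `Q_{s+2,t+1}` have the same character sum on EVERY scope pattern. -/
theorem quarterPair_scope_pattern :
    ∀ a b c d : Sym, stripFixed9 a b c d = true →
      ¬ (∀ f : Fin 4, ((![a, b, c, d] : Word) f).efree = true) → (![a, b, c, d] : Word) ≠ Word.eeee → (![a, b, c, d] : Word) ≠ Word.EEEE →
      ∀ s t : Fin 4, charSum9 ![a, b, c, d] (quarterKs s t) = charSum9 ![a, b, c, d] (quarterKs (s + 2) (t + 1)) := by
  decide +kernel

/-- … while on `eeee` they differ by `32·(−i)^s`. -/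
theorem quarterPair_eeee : ∀ s t : Fin 4,
    charSum9 Word.eeee (quarterKs s t) - charSum9 Word.eeee (quarterKs (s + 2) (t + 1)) = 32 * (⟨0, -1⟩ : GaussianInt) ^ s.val := by
  decide +kernel

/-- **SPLIT PAIR.** word form, via the strip bridge (as in `HalfCosetGadget.halfCoset_kills_scope`). -/
theorem quarterPair_scope (w : Word) (h1 : ¬ w.efree) (h2 : w ≠ Word.eeee) (h3 : w ≠ Word.EEEE) (s t : Fin 4) :
    charSum9 w (quarterKs s t) = charSum9 w (quarterKs (s + 2) (t + 1)) := by
  rw [← charSum9_strip w (quarterKs s t), ← charSum9_strip w (quarterKs (s + 2) (t + 1))]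
  have hv : w.strip9 = ![(w 0).strip9, (w 1).strip9, (w 2).strip9, (w 3).strip9] := by
    funext f; fin_cases f <;> rfl
  have h1' : ¬ (∀ f : Fin 4, ((![(w 0).strip9, (w 1).strip9, (w 2).strip9, (w 3).strip9] : Word) f).efree = true) := by
    intro hall
    apply h1
    intro f
    have := hall f
    rw [← hv] at this
    simpa [Word.strip9, Sym.strip9_efree] using this
  have h2' : (![(w 0).strip9, (w 1).strip9, (w 2).strip9, (w 3).strip9] : Word) ≠ Word.eeee := by
    intro heq
    apply h2
    rw [← hv] at heq
    funext f
    have := congrFun heq f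
    simp only [Word.strip9, Word.eeee] at this
    exact (Sym.strip9_eq_e _).1 this
  have h3' : (![(w 0).strip9, (w 1).strip9, (w 2).strip9, (w 3).strip9] : Word) ≠ Word.EEEE := by
    intro heq
    apply h3
    rw [← hv] at heq
    funext f
    have := congrFun heq f
    simp only [Word.strip9, Word.EEEE] at this
    exact (Sym.strip9_eq_ebar _).1 this
  rw [hv]
  have hfix : stripFixed9 (w 0).strip9 (w 1).strip9 (w 2).strip9 (w 3).strip9 = true := by
    simp [stripFixed9, Sym.strip9_strip9]
  exact quarterPair_scope_pattern _ _ _ _ hfix h1' h2' h3' s t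

/-! ### Design level: the split quarter pair `Q_{s,t}·x ⊂ N`, `Q_{s+2,t+1}·x ⊂ P` -/

/-- the split pair on a base cell `x`: 16 N-cells `rotCell k x (k ∈ Q_{s,t})` and 16 P-cells `rotCell k x (k ∈ Q_{s+2,t+1})`. -/
def splitQuarterDesign (x : Cell) (s t : Fin 4) : Design :=
  ⟨(quarterKs s t).map fun k => (rotCell k x, 1), (quarterKs (s + 2) (t + 1)).map fun k => (rotCell k x, 1)⟩

theorem rot_wsum9 (x : Cell) (w : Word) (L : List (Fin 4 → Fin 4)) :
    ((L.map fun k => (rotCell k x, 1)).map fun cm : Cell × ℕ => (cm.2 : GaussianInt) * cellCoef cm.1 w).sum = charSum9 w L * cellCoef x w := by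
  unfold charSum9
  simp only [List.map_map]
  rw [← List.sum_map_mul_right]
  congr 1
  apply List.map_congr_left
  intro k _
  simp [Function.comp, cellCoef_rotCell_phase]

theorem splitQuarterDesign_T (x : Cell) (s t : Fin 4) (w : Word) :
    (splitQuarterDesign x s t).T w = (charSum9 w (quarterKs s t) - charSum9 w (quarterKs (s + 2) (t + 1))) * cellCoef x w := by
  unfold splitQuarterDesign Design.T
  rw [rot_wsum9, rot_wsum9, sub_mul]

/-- (A1).1 holds for the split pair alone, for EVERY base cell. -/
theorem splitQuarterDesign_mixed_clean (x : Cell) (s t : Fin 4) :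
    ∀ w : Word, ¬ w.efree → w ≠ Word.eeee → w ≠ Word.EEEE → (splitQuarterDesign x s t).T w = 0 := by
  intro w h1 h2 h3
  rw [splitQuarterDesign_T, quarterPair_scope w h1 h2 h3 s t, sub_self, zero_mul]

/-- … with Bloch coefficient `32·(−i)^s·∏_f star β(x_f)`. -/
theorem splitQuarterDesign_mu (x : Cell) (s t : Fin 4) :
    (splitQuarterDesign x s t).mu = 32 * (⟨0, -1⟩ : GaussianInt) ^ s.val * cellCoef x Word.eeee := by
  unfold Design.mu
  rw [splitQuarterDesign_T, quarterPair_eeee s t]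

theorem snd_wsum_rot9 (x : Cell) (L : List (Fin 4 → Fin 4)) : ((L.map fun k => (rotCell k x, 1)).map Prod.snd).sum = L.length := by
  rw [List.map_map]
  have h : (Prod.snd ∘ fun k : Fin 4 → Fin 4 => (rotCell k x, 1)) = fun _ => 1 := by funext k; rfl
  rw [h, List.map_const', List.sum_replicate, smul_eq_mul, mul_one]

/-- the split pair has rank 0 (16 − 16) and 32 copies. -/
theorem splitQuarterDesign_rank_copies (x : Cell) (s t : Fin 4) :
    (splitQuarterDesign x s t).rank = 0 ∧ (splitQuarterDesign x s t).copies = 32 := by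
  unfold splitQuarterDesign Design.rank Design.copies
  rw [snd_wsum_rot9, snd_wsum_rot9, quarterKs_length, quarterKs_length]
  norm_num

/-! ### The even-sign octet `E₈` -/

/-- `E₈ = {k ∈ {0,2}⁴ : the number of slots with k_f = 2 is even}` (8 rotation vectors; annihilator `{0,2}⁴ ∪ {1,3}⁴`). -/
def evenSignKs9 : List (Fin 4 → Fin 4) :=
  allK9.filter fun k => decide ((∀ f : Fin 4, (k f).val % 2 = 0) ∧ ((k 0).val + (k 1).val + (k 2).val + (k 3).val) % 4 = 0)

/-- some slot carries the stripped symbol `1` (the pattern is NOT all-charged). -/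
def hasOne9 (a b c d : Sym) : Bool := decide (a = Sym.one ∨ b = Sym.one ∨ c = Sym.one ∨ d = Sym.one)

/-- **OCTET.** `E₈` kills every scope pattern with an e-free slot, and has character sum `8` on every all-charged scope pattern and on
`eeee` (so it is clean exactly OFF the 14 scalar patterns; 8 cells, `μ`-character 8). -/
theorem evenSign_scalar_only :
    evenSignKs9.length = 8 ∧ charSum9 Word.eeee evenSignKs9 = 8 ∧
    ∀ a b c d : Sym, stripFixed9 a b c d = true → ¬ (∀ f : Fin 4, ((![a, b, c, d] : Word) f).efree = true) →
      (hasOne9 a b c d = true → charSum9 ![a, b, c, d] evenSignKs9 = 0) ∧ (hasOne9 a b c d = false → charSum9 ![a, b, c, d] evenSignKs9 = 8) := by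
  decide +kernel

end quartercoset

end Summit.HodgeConjecture.HodgeConjecture.Cruxes.BlochSeedDiscOne.DepthBoundA4
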